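import Mathlib
import HarnessLib
import Summits.Ventures.LatticeQCDFlow.Exactness.PTMetaDAdaptiveRedraw

/-!
# PTBC with a ladder RE-TUNED between swaps: the physical replica stays exact at every time, for every tuning rule, provided the defect replica is re-equilibrated at the new coupling before the next swap

HONEST FRAMING: exact (Metropolis-corrected) sampling algorithms for lattice gauge theory;
figures of merit are autocorrelation/cost numbers at stated couplings and volumes; no
continuum-physics claim.

Venture `LatticeQCDFlow` (cell pub-lqcd), topic `Exactness`; FANOUT row 22 (`su3-ptbc`, PTBC arm E4).
NEW WORK of the cell = an INSTANCE of gen-3's `Exactness/PTMetaDAdaptiveRedraw.lean` (there: a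
measurement stream with action `S` and a second stream with action `S + B v`, the "bias" `B v` indexed by
ANY measurable space and updated by ANY measurable rule between exchanges; one round = redraw the second
stream at the current index → exchange Metropolis-tested at the current index → update the index).
Nothing is cited as a fact.

## Why row 22 wants it (value-free)

The PTBC ladder `c(0) = 1 > c(1) > … > c(N_r − 1) = 0` is TUNED from measured pair acceptances
(CARD-su3-ptbc §1.6 "equal-acceptance re-spacing"; hash rule §1.5: production rows hash the RULE and
record the tuned ladder as an outcome; §2 / §14: thermalisation, then an EQUILIBRATION segment after the
ladder is fixed, then production).  While the couplings move, the product of the tempered Gibbs laws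
moves with them and the replica process is not a time-homogeneous chain with a known invariant law.
Reading the defect replica of a two-replica ladder as the "biased stream" with bias
`B c = S_c − S` (`retuneBias`) makes gen-3's theorem apply verbatim:

* §1 `retuneBias`, **`adaptiveEnergy_retune`** (the pair energy at ladder parameter `c` is the PTBC pair
  energy `S x + S_c y`), **`involAccept_retune`** (the exchange test is the PTBC test
  `min {1, e^{−ΔS}}`, `ΔS = S y + S_c x − S x − S_c y`, `Exactness/PTBCSwap.involAccept_ptbcSwap`);
  `measurable_uncurry_retuneBias`.
* §2 **`ptbcRetune_round`** / **`ptbcRetune_iterate`** — for EVERY measurable family of defect actions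
  `S_c`, EVERY measurable re-tuning rule `F : 𝓥 × Ω → 𝓥` (new coupling from the old one and the defect
  replica's configuration — equal-acceptance re-spacing from measured acceptances is such a rule once the
  acceptance record is carried in `𝓥`, which may be any measurable space) and every law `m` of the
  current coupling: if before each swap the defect replica is REDRAWN from `e^{−S_c}·vol` at the current
  `c`, then one round maps `(e^{−S}vol) ⊗ m` to `(e^{−S}vol) ⊗ m'` and after `t` rounds the joint law of
  (physical configuration, coupling) is `(e^{−S}vol) ⊗ (biasStep^[t] m₀)` — THE PHYSICAL REPLICA IS
  EXACTLY PHYSICAL AND INDEPENDENT OF THE LADDER AT EVERY TIME; **`ptbcRetune_iterate_fst`** — normalised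
  reading: its marginal IS the physical law; exact in-replica updates of the physical replica in between change
  nothing (`PTMetaDAdaptiveRedraw.measurement_update_comp_prod`, imported).
* The protocol consequence is the card's: re-tune, then RE-EQUILIBRATE the defect replicas at the frozen
  ladder before measuring (the redraw is the idealisation of "enough heat-bath sweeps at fixed `c`").
  WITHOUT re-equilibration the statement is false in general — gen-3's two-state witnesses
  (`PTMetaDAdaptiveWitness.lean`) read with `V ∘ Q := S_c − S` (named, not re-typed).

NOT CLAIMED: ladders with more than one defect replica (the same argument needs ALL defect replicas
re-equilibrated jointly; not typed); how many sweeps approximate a redraw (row 9's Doeblin rates bound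
it; not composed here); anything about a run.
-/

noncomputable section

namespace Summit.Ventures.LatticeQCDFlow.Exactness

open MeasureTheory ProbabilityTheory Real
open scoped ENNReal ProbabilityTheory

variable {Ω : Type*} [MeasurableSpace Ω] {𝓥 : Type*} [MeasurableSpace 𝓥]

/-! ## §1 The defect replica as a "biased stream": `B c = S_c − S` -/

section Bias

variable (Sc : 𝓥 → Ω → ℝ) (S : Ω → ℝ)

/-- **The re-tuning bias**: the defect replica at ladder parameter `c` has action `S_c = S + (S_c − S)`;
`retuneBias Sc S c = S_c − S`. [ours] -/
def retuneBias : 𝓥 → Ω → ℝ := fun c y => Sc c y - S y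

omit [MeasurableSpace Ω] [MeasurableSpace 𝓥] in
/-- `retuneBias` unfolded. [ours] -/
@[simp] theorem retuneBias_apply (c : 𝓥) (y : Ω) : retuneBias Sc S c y = Sc c y - S y := rfl

omit [MeasurableSpace Ω] [MeasurableSpace 𝓥] in
/-- **The pair energy at the current ladder parameter is the PTBC two-action energy**:
`S x + (S y + (S_c y − S y)) = S x + S_c y`. [ours] -/
theorem adaptiveEnergy_retune (x y : Ω) (c : 𝓥) :
    adaptiveEnergy S (retuneBias Sc S) (x, (c, y)) = S x + Sc c y := by
  simp only [adaptiveEnergy, retuneBias_apply]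
  ring

omit [MeasurableSpace Ω] [MeasurableSpace 𝓥] in
/-- **The exchange test is the PTBC swap test** at the current couplings: acceptance
`min {1, exp (−ΔS)}` with `ΔS = S y + S_c x − S x − S_c y` (replica `S` would receive `y`, replica `S_c`
would receive `x`; `Exactness/PTBCSwap.involAccept_ptbcSwap`). [ours] -/
theorem involAccept_retune (x y : Ω) (c : 𝓥) :
    involAccept (adaptiveEnergy S (retuneBias Sc S)) adaptiveSwapMap (x, (c, y)) =
      min 1 (Real.exp (-(S y + Sc c x - S x - Sc c y))) := by
  rw [involAccept_adaptive]
  simp only [retuneBias_apply]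
  congr 2
  ring

/-- Joint measurability of the bias from that of the defect-action family and of `S`. [ours] -/
theorem measurable_uncurry_retuneBias (hSc : Measurable (Function.uncurry Sc)) (hS : Measurable S) :
    Measurable (Function.uncurry (retuneBias Sc S)) := by
  have h : Function.uncurry (retuneBias Sc S) = fun p : 𝓥 × Ω => Function.uncurry Sc p - S p.2 := by
    funext p; rfl
  rw [h]
  exact hSc.sub (hS.comp measurable_snd)

end Bias

/-! ## §2 Re-tune with re-equilibration: the physical replica is exact at every time -/

section Retune

variable {vol : Measure Ω} [SFinite vol] {Sc : 𝓥 → Ω → ℝ} {S : Ω → ℝ}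

/-- **ONE RE-TUNED ROUND keeps the physical replica physical and independent of the ladder**: for every
s-finite law `m` of the current coupling and every measurable re-tuning rule `F`,
`round ∘ₘ ((e^{−S}vol) ⊗ m) = (e^{−S}vol) ⊗ biasStep m` (round = redraw the defect replica at the
current coupling, PTBC swap, re-tune). [ours] -/
theorem ptbcRetune_round (hSc : Measurable (Function.uncurry Sc)) (hS : Measurable S)
    {F : 𝓥 × Ω → 𝓥} (hF : Measurable F) (m : Measure 𝓥) [SFinite m] :
    adaptiveRound vol S (retuneBias Sc S) F hF ∘ₘ
        ((vol.withDensity fun x => ENNReal.ofReal (Real.exp (-S x))).prod m) =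
      (vol.withDensity fun x => ENNReal.ofReal (Real.exp (-S x))).prod
        (biasStep vol S (retuneBias Sc S) F m) :=
  adaptiveRound_comp_prod hS (measurable_uncurry_retuneBias Sc S hSc hS) hF m

/-- **ALL TIMES**: after `t` re-tuned rounds from `(e^{−S}vol) ⊗ m₀` the joint law of (physical
configuration, current coupling) is `(e^{−S}vol) ⊗ (biasStep^[t] m₀)` — the physical replica is
EXACTLY physical, and independent of the ladder, at every time and for every re-tuning rule. [ours] -/
theorem ptbcRetune_iterate (hSc : Measurable (Function.uncurry Sc)) (hS : Measurable S)
    {F : 𝓥 × Ω → 𝓥} (hF : Measurable F) (m₀ : Measure 𝓥) [SFinite m₀] (t : ℕ) :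
    (fun μ : Measure (Ω × 𝓥) => adaptiveRound vol S (retuneBias Sc S) F hF ∘ₘ μ)^[t]
        ((vol.withDensity fun x => ENNReal.ofReal (Real.exp (-S x))).prod m₀) =
      (vol.withDensity fun x => ENNReal.ofReal (Real.exp (-S x))).prod
        ((biasStep vol S (retuneBias Sc S) F)^[t] m₀) :=
  (adaptiveRound_iterate hS (measurable_uncurry_retuneBias Sc S hSc hS) hF m₀ t).1

/-- **Normalised reading**: with the physical law a probability law and the redraw kernel Markov (each
`e^{−S_c}vol` normalised — put `log Z_c` into `S_c`, the swap test is unchanged), THE MARGINAL LAW OF THE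
PHYSICAL REPLICA AFTER `t` RE-TUNED ROUNDS IS THE PHYSICAL LAW. [ours] -/
theorem ptbcRetune_iterate_fst (hSc : Measurable (Function.uncurry Sc)) (hS : Measurable S)
    {F : 𝓥 × Ω → 𝓥} (hF : Measurable F)
    [IsProbabilityMeasure (vol.withDensity fun x => ENNReal.ofReal (Real.exp (-S x)))]
    [IsMarkovKernel (biasedKernel vol S (retuneBias Sc S))] (m₀ : Measure 𝓥) [IsProbabilityMeasure m₀]
    (t : ℕ) :
    ((fun μ : Measure (Ω × 𝓥) => adaptiveRound vol S (retuneBias Sc S) F hF ∘ₘ μ)^[t]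
        ((vol.withDensity fun x => ENNReal.ofReal (Real.exp (-S x))).prod m₀)).fst =
      (vol.withDensity fun x => ENNReal.ofReal (Real.exp (-S x))) :=
  (adaptiveRound_iterate_fst hS (measurable_uncurry_retuneBias Sc S hSc hS) hF m₀ t).2

-- Exact in-replica updates of the physical replica in between change nothing: this is literally
-- `measurement_update_comp_prod` of `PTMetaDAdaptiveRedraw.lean` (imported; not restated).

end Retune

end Summit.Ventures.LatticeQCDFlow.Exactness

end
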